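import Summits.ResolutionOfSingularities.ResolutionOfSingularities.Theorems.HilbertSamuelEliminationSigmaMaxModificationsCorridor3CPFramePropagationLocal
import Summits.ResolutionOfSingularities.ResolutionOfSingularities.Theorems.HilbertSamuelEliminationSigmaMaxModificationsCorridor3CPFramePropagationComplete
import HarnessLib

/-!
# [OURS · L1 W4.2] D18 (G8): the near-point frame links G5 (ii-c)/(ii-d) RE-PROVED WITH THE FRAME-TRANSITION MAPS — the presentation at
# `x'` FACTORS through an explicit ring map of frame rings compatible with constants and the variable
# (cell res-hironaka, LADDER-RESOLUTION rung L; slot W4.2, crux chain w42 `SigmaMaxModificationsCorridor3` stmt-ResolutionOfSingularities-19249;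
# `--supports stmt-ResolutionOfSingularities-19249 --as helper`; res-L1-w42-plan-1 RULING v3.14-42 part 2 (KG)(2) «(G8) E-adapted propagation»;
# hand res-D-brk-3 (gen 7), file F2a of DESIGN 17:06:09Z)

PURE COMMUTATIVE ALGEBRA, 0 `def`s, every declaration PROVED; OURS bookkeeping; NOT a statement of Hironaka's manuscript [Hironaka2017] nor of
[CossartJannsenSaito2020]/[CossartPiltant2019]. AI-written, weaker than expert review.

WHY. To propagate an E-ADAPTED frame (boundary members read as coordinate hyperplanes `(u_j)`), the new frame's presentation `φ'` must be
COMPARED with the old one: `φ' ∘ π♯ = β ∘ φ` for a ring map `β : R[X]/(h) → R'[X]/(h')` whose action on the constants `R` and on `X` is known.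
The landed links `exists_local_frame_of_chart_presentation` (p544651) and `exists_complete_minimal_frame` (p544990) return the new presentation
only existentially; here the SAME constructions are re-run returning the transition maps:

* `exists_local_frame_of_chart_presentation_tracked` — G5 (ii-c) plus `β₃ : (S[X]/(h'))_{𝔔₃} → S_𝔮[X]/(h₁)` with `φ₁ = β₃ ∘ ψ₃`,
  `β₃(s) = s` on constants `s ∈ S` and `β₃(X̄') = X + θ'` (the iso `(S[X]/(h'))_{𝔔₃} ≅ S_𝔮[X]/(h'^{S_𝔮})` of p527785 followed by the
  translation `X ↦ X + θ'`).
* `exists_complete_minimal_frame_tracked` — G5 (ii-d) with the r.s.p. `u₁` of the base PRESCRIBED (the completed frame's r.s.p. is its image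
  `ι ∘ u₁`, `ι : R₁ → R̂₁`) plus `β₄ : R₁[X]/(h₁) → R̂₁[X]/(h₂)` with `φ₂ = β₄ ∘ φ₁`, `β₄(r) = ι(r)`, `β₄(X̄) = X + θ` (completion followed by
  Hironaka's vertex preparation, res-lit-4's `exists_mem_span_isMinimal_comp_X_add_C_of_span_eq_maximalIdeal`).

References: CP 2019 Prop. 2.6–2.7 [CossartPiltant2019]; CJS LNM 2270 Thm. 2.3 [CossartJannsenSaito2020]; Matsumura Thms. 8.8, 8.14 [Matsumura1987];
tree p544651, p544990 (the untracked originals, whose proofs are repeated verbatim up to the last line).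
-/

noncomputable section

set_option linter.dupNamespace false

open IsLocalRing IsLocalization Polynomial
open Literature.AlgebraicGeometry.Resolution Literature.RingTheory.HilbertSamuel
open Summit.ResolutionOfSingularities.ResolutionOfSingularities.Theorems.SigmaMaxModificationsCorridor3.Moving

namespace Summit.ResolutionOfSingularities.ResolutionOfSingularities.Theorems.SigmaMaxModificationsCorridor3.Helpers

/-- [OURS · L1 W4.2] **G5 (ii-c) tracked: the frame at a near point over `S_𝔮`, with the transition map.** [cite: CossartPiltant2019, Prop. 2.6 and (2.7) (arXiv v1 pp. 13–14)]
[cite: CossartJannsenSaito2020, Thm. 2.3, §2.2] -/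
theorem exists_local_frame_of_chart_presentation_tracked {R : Type} [CommRing R] [IsRegularLocalRing R] {h : R[X]} (hmo : h.Monic)
    (hm : 0 < h.natDegree) (hco : ∀ i < h.natDegree, h.coeff i ∈ maximalIdeal R ^ (h.natDegree - i)) [IsLocalRing (AdjoinRoot h)]
    {S : Type} [CommRing S] [IsDomain S] [IsNoetherianRing S] (q : Ideal S) [q.IsPrime]
    (hreg : IsRegularLocalRing (Localization.AtPrime q)) {h' : S[X]} (hmon' : h'.Monic) (hdeg' : h'.natDegree = h.natDegree)
    (𝔔₃ : Ideal (AdjoinRoot h')) [𝔔₃.IsPrime] (hq : (𝔔₃.comap (AdjoinRoot.mk h')).comap C = q)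
    {O₀ : Type} [CommRing O₀] [IsLocalRing O₀] [IsNoetherianRing O₀] (ψ₃ : O₀ →+* Localization.AtPrime 𝔔₃)
    (hflat : @RingHom.Flat O₀ (Localization.AtPrime 𝔔₃) _ _ ψ₃) (hloc : IsLocalHom ψ₃)
    (hmap : (maximalIdeal O₀).map ψ₃ = maximalIdeal (Localization.AtPrime 𝔔₃))
    (hres : Function.Surjective ((residue (Localization.AtPrime 𝔔₃)).comp ψ₃))
    (hH : hilbertFun O₀ = hilbertFun (AdjoinRoot h)) (hdimO : ringKrullDim O₀ = ringKrullDim (AdjoinRoot h)) :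
    ∃ (θ' : Localization.AtPrime q)
      (_ : IsLocalRing ((Localization.AtPrime q)[X] ⧸ Ideal.span {(h'.map (algebraMap S (Localization.AtPrime q))).comp (X + C θ')}))
      (φ₁ : O₀ →+* (Localization.AtPrime q)[X] ⧸ Ideal.span {(h'.map (algebraMap S (Localization.AtPrime q))).comp (X + C θ')}),
      ringKrullDim (Localization.AtPrime q) = ringKrullDim R ∧
      ((h'.map (algebraMap S (Localization.AtPrime q))).comp (X + C θ')).Monic ∧
      ((h'.map (algebraMap S (Localization.AtPrime q))).comp (X + C θ')).natDegree = h.natDegree ∧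
      (∀ i < h.natDegree, ((h'.map (algebraMap S (Localization.AtPrime q))).comp (X + C θ')).coeff i ∈
        maximalIdeal (Localization.AtPrime q) ^ (h.natDegree - i)) ∧
      @RingHom.Flat O₀ ((Localization.AtPrime q)[X] ⧸
        Ideal.span {(h'.map (algebraMap S (Localization.AtPrime q))).comp (X + C θ')}) _ _ φ₁ ∧ IsLocalHom φ₁ ∧
      (maximalIdeal O₀).map φ₁ = maximalIdeal ((Localization.AtPrime q)[X] ⧸
        Ideal.span {(h'.map (algebraMap S (Localization.AtPrime q))).comp (X + C θ')}) ∧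
      Function.Surjective ((residue ((Localization.AtPrime q)[X] ⧸
        Ideal.span {(h'.map (algebraMap S (Localization.AtPrime q))).comp (X + C θ')})).comp φ₁) ∧
      ∃ β : Localization.AtPrime 𝔔₃ →+* (Localization.AtPrime q)[X] ⧸
          Ideal.span {(h'.map (algebraMap S (Localization.AtPrime q))).comp (X + C θ')},
        (∀ o, φ₁ o = β (ψ₃ o)) ∧
        (∀ s : S, β (algebraMap (AdjoinRoot h') (Localization.AtPrime 𝔔₃) (AdjoinRoot.of h' s)) =
          Ideal.Quotient.mk _ (C (algebraMap S (Localization.AtPrime q) s))) ∧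
        β (algebraMap (AdjoinRoot h') (Localization.AtPrime 𝔔₃) (AdjoinRoot.root h')) = Ideal.Quotient.mk _ (X + C θ') := by
  haveI := hreg
  have hreg' : IsRegularLocalRing (Localization.AtPrime ((𝔔₃.comap (AdjoinRoot.mk h')).comap C)) := by
    subst hq
    exact hreg
  -- the Hilbert function and the dimension of `(S[X]/(h'))_{𝔔₃}`
  haveI : IsNoetherianRing (AdjoinRoot h') := inferInstance
  haveI : IsNoetherianRing (Localization.AtPrime 𝔔₃) := IsLocalization.isNoetherianRing 𝔔₃.primeCompl _ inferInstance
  letI algψ : Algebra O₀ (Localization.AtPrime 𝔔₃) := ψ₃.toAlgebra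
  haveI : Module.Flat O₀ (Localization.AtPrime 𝔔₃) := hflat
  haveI : IsLocalHom (algebraMap O₀ (Localization.AtPrime 𝔔₃)) := hloc
  have hH₃ : hilbertFun (Localization.AtPrime 𝔔₃) = hilbertFun (AdjoinRoot h) :=
    (hilbertFun_eq_of_flat_of_map_maximalIdeal_eq (A := O₀) (B := Localization.AtPrime 𝔔₃) hmap).trans hH
  have hdim₃ : ringKrullDim (Localization.AtPrime 𝔔₃) = ringKrullDim (AdjoinRoot h) :=
    (Literature.AlgebraicGeometry.Resolution.ringKrullDim_eq_of_flat_of_map_maximalIdeal_eq O₀ (Localization.AtPrime 𝔔₃) hmap).trans hdimO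
  -- near ⇒ order
  obtain ⟨s, hs, hsh⟩ := exists_mul_mem_pow_of_hilbertFun_eq hmo hm hco hmon' 𝔔₃ hreg' hH₃ hdim₃
  have hm' : 0 < h'.natDegree := by rw [hdeg']; exact hm
  have hord : ∃ s ∉ 𝔔₃.comap (AdjoinRoot.mk h'), s * h' ∈ (𝔔₃.comap (AdjoinRoot.mk h')) ^ h'.natDegree :=
    ⟨s, hs, by rw [hdeg']; exact hsh⟩
  -- NEAR-SHAPE (p529392) at `𝔮`
  obtain ⟨θ', h𝔔₄, hcomap, hfib, hmo₁, hdeg₁, hco₁, hweak⟩ :=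
    exists_frame_translate_localization_of_order q hmon' hm' hq hord
  -- the local ring `B' = S_𝔮[X]/(h')` (p527785) and `(S[X]/(h'))_{𝔔₃} ≅ B'`
  obtain ⟨hlocB', hmaxB', hq', hlocAt, huniq⟩ := adjoinRoot_localization_of_fibre q hmon' hm' θ' hweak
  haveI := hlocB'
  letI algM : Algebra (AdjoinRoot h') (AdjoinRoot (h'.map (algebraMap S (Localization.AtPrime q)))) :=
    (AdjoinRoot.map (algebraMap S (Localization.AtPrime q)) h' (h'.map (algebraMap S (Localization.AtPrime q))) dvd_rfl).toAlgebra
  have h𝔔₃eq : 𝔔₃ = (maximalIdeal (AdjoinRoot (h'.map (algebraMap S (Localization.AtPrime q))))).comap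
      (AdjoinRoot.map (algebraMap S (Localization.AtPrime q)) h' _ dvd_rfl) :=
    huniq 𝔔₃ inferInstance (by rw [show AdjoinRoot.of h' = (AdjoinRoot.mk h').comp C from rfl, ← Ideal.comap_comap]; exact hq)
  have hM : ((maximalIdeal (AdjoinRoot (h'.map (algebraMap S (Localization.AtPrime q))))).comap
      (AdjoinRoot.map (algebraMap S (Localization.AtPrime q)) h' _ dvd_rfl)).primeCompl = 𝔔₃.primeCompl := by
    ext x
    rw [Ideal.mem_primeCompl_iff, Ideal.mem_primeCompl_iff, ← h𝔔₃eq]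
  have hlocAt' : IsLocalization.AtPrime (AdjoinRoot (h'.map (algebraMap S (Localization.AtPrime q)))) 𝔔₃ := by
    have h1 := hlocAt
    change IsLocalization _ _ at h1
    change IsLocalization _ _
    rwa [hM] at h1
  let e₄ : Localization.AtPrime 𝔔₃ ≃ₐ[AdjoinRoot h'] AdjoinRoot (h'.map (algebraMap S (Localization.AtPrime q))) :=
    @IsLocalization.algEquiv (AdjoinRoot h') _ 𝔔₃.primeCompl (Localization.AtPrime 𝔔₃) _ _ _ _ _ _ hlocAt'
  -- the translation `X ↦ X − θ'`
  let e₅ : AdjoinRoot (h'.map (algebraMap S (Localization.AtPrime q))) ≃+*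
      (Localization.AtPrime q)[X] ⧸ Ideal.span {(h'.map (algebraMap S (Localization.AtPrime q))).comp (X + C θ')} :=
    Ideal.quotientEquiv (Ideal.span {h'.map (algebraMap S (Localization.AtPrime q))})
      (Ideal.span {(h'.map (algebraMap S (Localization.AtPrime q))).comp (X + C θ')})
      (algEquivAevalXAddC θ' : (Localization.AtPrime q)[X] ≃ₐ[Localization.AtPrime q] (Localization.AtPrime q)[X]).toRingEquiv
      (by rw [span_translate_eq_map]; rfl)
  haveI hloc₁ : IsLocalRing ((Localization.AtPrime q)[X] ⧸
      Ideal.span {(h'.map (algebraMap S (Localization.AtPrime q))).comp (X + C θ')}) := e₅.isLocalRing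
  -- the presentation on `S_𝔮[X]/(h₁)`
  obtain ⟨hf₄, hl₄, hm₄, hr₄⟩ := presentation_comp_ringEquiv (T := Localization.AtPrime 𝔔₃)
    (T' := AdjoinRoot (h'.map (algebraMap S (Localization.AtPrime q)))) ψ₃ hflat hloc hmap hres e₄.toRingEquiv
  obtain ⟨hf₅, hl₅, hm₅, hr₅⟩ := presentation_comp_ringEquiv (T := AdjoinRoot (h'.map (algebraMap S (Localization.AtPrime q))))
    (T' := (Localization.AtPrime q)[X] ⧸ Ideal.span {(h'.map (algebraMap S (Localization.AtPrime q))).comp (X + C θ')})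
    _ hf₄ hl₄ hm₄ hr₄ e₅
  -- the dimension of `S_𝔮`
  have hdimS : ringKrullDim (Localization.AtPrime q) = ringKrullDim R := by
    haveI : Module.Finite (Localization.AtPrime q) (AdjoinRoot (h'.map (algebraMap S (Localization.AtPrime q)))) :=
      (hmon'.map _).finite_adjoinRoot
    haveI : Module.Finite R (AdjoinRoot h) := hmo.finite_adjoinRoot
    haveI : IsDomain (Localization.AtPrime q) := isDomain_of_isRegularLocalRing _
    haveI : IsDomain R := isDomain_of_isRegularLocalRing R
    have hdegq : (h'.map (algebraMap S (Localization.AtPrime q))).degree ≠ 0 := by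
      rw [degree_eq_natDegree (hmon'.map _).ne_zero, hmon'.natDegree_map, hdeg']
      exact_mod_cast hm.ne'
    have hdegh : h.degree ≠ 0 := by
      rw [degree_eq_natDegree hmo.ne_zero]
      exact_mod_cast hm.ne'
    have h1 := Literature.RingTheory.KrullDimension.ringKrullDim_eq_of_isIntegral (R := Localization.AtPrime q)
      (S := AdjoinRoot (h'.map (algebraMap S (Localization.AtPrime q)))) (AdjoinRoot.of.injective_of_degree_ne_zero hdegq)
    have h2 := Literature.RingTheory.KrullDimension.ringKrullDim_eq_of_isIntegral (R := R) (S := AdjoinRoot h)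
      (AdjoinRoot.of.injective_of_degree_ne_zero hdegh)
    rw [h1, ← ringKrullDim_eq_of_ringEquiv e₄.toRingEquiv, hdim₃, h2]
  refine ⟨θ', hloc₁, _, hdimS, hmo₁, hdeg₁.trans hdeg', fun i hi => by
      have := hco₁ i (hdeg' ▸ hi); rwa [hdeg'] at this, hf₅, hl₅, hm₅, hr₅, ?_⟩
  -- the transition map `β₃ = e₅ ∘ e₄`
  refine ⟨(e₅ : AdjoinRoot (h'.map (algebraMap S (Localization.AtPrime q))) →+*
      (Localization.AtPrime q)[X] ⧸ Ideal.span {(h'.map (algebraMap S (Localization.AtPrime q))).comp (X + C θ')}).comp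
      (e₄.toRingEquiv : Localization.AtPrime 𝔔₃ →+* AdjoinRoot (h'.map (algebraMap S (Localization.AtPrime q)))),
    fun o => by rw [RingHom.comp_apply, RingHom.comp_apply, RingHom.comp_apply], fun s => ?_, ?_⟩
  · -- constants
    have h1 : e₄ (algebraMap (AdjoinRoot h') (Localization.AtPrime 𝔔₃) (AdjoinRoot.of h' s)) =
        AdjoinRoot.of (h'.map (algebraMap S (Localization.AtPrime q))) (algebraMap S (Localization.AtPrime q) s) := by
      rw [e₄.commutes, RingHom.algebraMap_toAlgebra, AdjoinRoot.map_of]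
    rw [RingHom.comp_apply]
    simp only [RingHom.coe_coe, AlgEquiv.coe_ringEquiv]
    rw [h1]
    show Ideal.quotientEquiv _ _ _ _ (Ideal.Quotient.mk _ (C (algebraMap S (Localization.AtPrime q) s))) = _
    rw [Ideal.quotientEquiv_mk]
    congr 1
    simp only [AlgEquiv.coe_ringEquiv, Moving.algEquivAevalXAddC_apply, C_comp]
  · -- the variable
    have h1 : e₄ (algebraMap (AdjoinRoot h') (Localization.AtPrime 𝔔₃) (AdjoinRoot.root h')) =
        AdjoinRoot.root (h'.map (algebraMap S (Localization.AtPrime q))) := by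
      rw [e₄.commutes, RingHom.algebraMap_toAlgebra, AdjoinRoot.map_root]
    rw [RingHom.comp_apply]
    simp only [RingHom.coe_coe, AlgEquiv.coe_ringEquiv]
    rw [h1]
    show Ideal.quotientEquiv _ _ _ _ (Ideal.Quotient.mk _ X) = _
    rw [Ideal.quotientEquiv_mk]
    congr 1
    simp only [AlgEquiv.coe_ringEquiv, Moving.algEquivAevalXAddC_apply, X_comp]

/-- [OURS · L1 W4.2] **G5 (ii-d) tracked: completion and vertex preparation with a PRESCRIBED r.s.p., with the transition map.**
[cite: CossartPiltant2019, Prop. 2.2–2.3, Def. 2.4 (arXiv v1 pp. 11–12)] [cite: Matsumura1987, Thm. 8.14] -/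
theorem exists_complete_minimal_frame_tracked {R₁ : Type} [CommRing R₁] [IsRegularLocalRing R₁] (hdim : ringKrullDim R₁ = (3 : ℕ))
    {h₁ : R₁[X]} (hmo : h₁.Monic) (hm : 0 < h₁.natDegree) (hco : ∀ i < h₁.natDegree, h₁.coeff i ∈ maximalIdeal R₁ ^ (h₁.natDegree - i))
    [IsLocalRing (R₁[X] ⧸ Ideal.span {h₁})] {O₀ : Type} [CommRing O₀] [IsLocalRing O₀] (φ₁ : O₀ →+* R₁[X] ⧸ Ideal.span {h₁})
    (hloc : IsLocalHom φ₁) (hflat : φ₁.Flat) (hmap : (maximalIdeal O₀).map φ₁ = maximalIdeal _)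
    (hres : Function.Surjective ((residue _).comp φ₁)) (u₁ : Fin 3 → R₁) (hu₁ : Ideal.span (Set.range u₁) = maximalIdeal R₁) :
    ∃ (R' : Type) (_ : CommRing R') (_ : IsRegularLocalRing R') (ι : R₁ →+* R') (θ : R') (h₂ : R'[X])
      (_ : IsLocalRing (R'[X] ⧸ Ideal.span {h₂})) (φ₂ : O₀ →+* R'[X] ⧸ Ideal.span {h₂})
      (β : (R₁[X] ⧸ Ideal.span {h₁}) →+* R'[X] ⧸ Ideal.span {h₂}),
      IsAdicComplete (maximalIdeal R') R' ∧ ringKrullDim R' = 3 ∧ Ideal.span (Set.range (ι ∘ u₁)) = maximalIdeal R' ∧ h₂.Monic ∧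
      h₂.natDegree = h₁.natDegree ∧ (∀ i < h₂.natDegree, h₂.coeff i ∈ maximalIdeal R' ^ (h₂.natDegree - i)) ∧
      IsLocalHom φ₂ ∧ φ₂.Flat ∧ (maximalIdeal O₀).map φ₂ = maximalIdeal _ ∧ Function.Surjective ((residue _).comp φ₂) ∧
      CossartPiltant.IsMinimal (ι ∘ u₁) h₂ ∧
      (∀ o, φ₂ o = β (φ₁ o)) ∧ (∀ r : R₁, β (Ideal.Quotient.mk _ (C r)) = Ideal.Quotient.mk _ (C (ι r))) ∧
      β (Ideal.Quotient.mk _ X) = Ideal.Quotient.mk _ (X + C θ) := by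
  -- the r.s.p. `u₁` of `R₁`
  have hd : (maximalIdeal R₁).spanFinrank = 3 := CossartPiltant.spanFinrank_maximalIdeal_eq_of_ringKrullDim_eq hdim
  -- completing the base
  obtain ⟨hreg, hcpl, hdim', hu', hmon', hdeg', hcoef'⟩ := adicCompletion_frame_data hu₁ hmo
  obtain ⟨hloc', hψloc, hψflat, hψmap, hψres⟩ :=
    adicCompletion_presentation hmo hm (fun i hi => Ideal.pow_le_self (by omega) (hco i hi)) hloc hflat hmap hres
  haveI := hreg
  haveI := hloc'
  set R' := AdicCompletion (maximalIdeal R₁) R₁ with hR'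
  set hh := h₁.map (algebraMap R₁ R') with hhh
  have hdim3 : ringKrullDim R' = (3 : ℕ) := hdim'.trans hdim
  -- vertex preparation with `θ ∈ 𝔪`, keeping `δ ≥ 1`
  have hcoefIcc : ∀ i ∈ Finset.Icc 1 hh.natDegree,
      hh.coeff (hh.natDegree - i) ∈ Ideal.span ((algebraMap R₁ R' ∘ u₁) '' ↑(Finset.univ : Finset (Fin 3))) ^ i := by
    intro i hi
    rw [Finset.coe_univ, Set.image_univ, hu', hdeg']
    have hi' := Finset.mem_Icc.mp hi
    have h1 := hcoef' (h₁.natDegree - i) (h₁.natDegree - (h₁.natDegree - i)) (hco _ (by omega))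
    rwa [show h₁.natDegree - (h₁.natDegree - i) = i by omega] at h1
  obtain ⟨θ, hθ, hmin, hcoef₂⟩ := CossartPiltant.exists_mem_span_isMinimal_comp_X_add_C_of_span_eq_maximalIdeal
    (algebraMap R₁ R' ∘ u₁) hu' hdim3 hmon' Finset.univ hcoefIcc
  -- the translate and its presentation
  have hmon₂ : (hh.comp (X + C θ)).Monic := hmon'.comp (monic_X_add_C θ) (by rw [natDegree_X_add_C]; exact one_ne_zero)
  have hdeg₂ : (hh.comp (X + C θ)).natDegree = h₁.natDegree := by
    rw [← hdeg', ← taylor_apply, natDegree_taylor]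
  let e : (R'[X] ⧸ Ideal.span {hh}) ≃+* R'[X] ⧸ Ideal.span {hh.comp (X + C θ)} :=
    Ideal.quotientEquiv (Ideal.span {hh}) (Ideal.span {hh.comp (X + C θ)})
      (algEquivAevalXAddC θ : R'[X] ≃ₐ[R'] R'[X]).toRingEquiv (by rw [span_translate_eq_map]; rfl)
  haveI hloc₂ : IsLocalRing (R'[X] ⧸ Ideal.span {hh.comp (X + C θ)}) := e.isLocalRing
  obtain ⟨hf₂, hl₂, hm₂, hr₂⟩ := presentation_comp_ringEquiv _ hψflat hψloc hψmap hψres e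
  refine ⟨R', inferInstance, hreg, algebraMap R₁ R', θ, hh.comp (X + C θ), hloc₂, _,
    (e : (R'[X] ⧸ Ideal.span {hh}) →+* R'[X] ⧸ Ideal.span {hh.comp (X + C θ)}).comp
      (Ideal.quotientMap (Ideal.span {hh}) (mapRingHom (algebraMap R₁ R')) (span_le_comap_span_map h₁)),
    hcpl, hdim3, hu', hmon₂, hdeg₂, ?_, hl₂, hf₂, hm₂, hr₂, hmin,
    fun o => by rw [RingHom.comp_apply, RingHom.comp_apply, RingHom.comp_apply], fun r => ?_, ?_⟩
  · intro i hi
    rw [hdeg₂] at hi ⊢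
    have h1 := hcoef₂ (h₁.natDegree - i) (Finset.mem_Icc.mpr ⟨by omega, by omega⟩)
    rw [hdeg', show h₁.natDegree - (h₁.natDegree - i) = i by omega, Finset.coe_univ, Set.image_univ, hu'] at h1
    exact h1
  · rw [RingHom.comp_apply, Ideal.quotientMap_mk, Polynomial.coe_mapRingHom, Polynomial.map_C]
    show Ideal.quotientEquiv _ _ _ _ (Ideal.Quotient.mk _ (C (algebraMap R₁ R' r))) = _
    rw [Ideal.quotientEquiv_mk]
    congr 1
    simp only [AlgEquiv.coe_ringEquiv, Moving.algEquivAevalXAddC_apply, C_comp]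
  · rw [RingHom.comp_apply, Ideal.quotientMap_mk, Polynomial.coe_mapRingHom, Polynomial.map_X]
    show Ideal.quotientEquiv _ _ _ _ (Ideal.Quotient.mk _ X) = _
    rw [Ideal.quotientEquiv_mk]
    congr 1
    simp only [AlgEquiv.coe_ringEquiv, Moving.algEquivAevalXAddC_apply, X_comp]

end Summit.ResolutionOfSingularities.ResolutionOfSingularities.Theorems.SigmaMaxModificationsCorridor3.Helpers

end
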